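import Mathlib.Analysis.Complex.Exponential
import Literature.NumberTheory.LFunctions.WeilArchimedeanPositivityProofs
import Literature.NumberTheory.LFunctions.WeilMellinInversion
import Literature.Analysis.FunctionSpaces.PlancherelL1L2
import Literature.Analysis.SpecialFunctions.DigammaVerticalSeries
import HarnessLib

/-!
# Weil positivity at the archimedean place: the moment toolkit

Sibling of `Literature/NumberTheory/LFunctions/WeilArchimedeanPositivityProofs.lean` (Yoshida's
analytic form `E(g) = 2 Re(ĝ(0) conj ĝ(1)) − (log π)‖g‖₂² + (1/2π) ∫ |ĝ(1/2+it)|² Re ψ(1/4+it/2) dt`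
of Weil's quadratic functional on `C(a)`, `a = (log 2)/2`; H. Yoshida, Adv. Stud. Pure Math. 21
(1992), §2 (2.1) and §6). Yoshida proves `E ≥ 0` on `K(a)` (Theorem 1, p. 310) by reducing the
hermitian form to finitely many coordinates and a machine computation. This file provides the
analytic lemmas of such a reduction in the coordinates used by the certificate of
`WeilPositivityCertificate.lean`, namely the *scaled moments* `M_k(g) = ∫ g(x) (x/a)^k dx` of a
test function supported in `[-a, a]`:

* `weilMoment`, `weilNorm1` (`= weilL1W 0`, `weilNorm1_eq_weilL1W_zero`; cf. `weilL1W`,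
  `weilDecayW` of `WeilMellinInversion.lean`), `weilNorm2Sq` and the elementary bounds
  `‖M_k‖ ≤ ‖g‖₁`, `‖g‖₁² ≤ 2a ‖g‖₂²` (`norm_weilMoment_le`, `weilNorm1_sq_le`);
* the **Taylor–moment lemma** `norm_weilMellin_sub_sum_weilMoment_le`: for `‖c‖a ≤ (N+2)/2`,
  `‖ĝ(c + 1/2) − Σ_{m≤N} (ca)^m/m! M_m‖ ≤ 2(‖c‖a)^{N+1}/(N+1)! ‖g‖₁` (from `Complex.exp_bound'`),
  used at `c = ±1/2` (the polar term `ĝ(0), ĝ(1)`) and `c = it` (the critical line);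
* **Plancherel** in the `weilMellin` normalisation, `∫ ‖ĝ(1/2+it)‖² dt = 2π ‖g‖₂²`
  (`integral_norm_sq_weilMellin_half_line`, from `Literature.Analysis.FunctionSpaces.integral_norm_sq_fourierIntegral_eq` and
  `Literature.NumberTheory.LFunctions.fourier_weilKernel`), integrability of `‖ĝ(1/2+it)‖² F(t)` for measurable weights of
  quadratic growth, and the **minorant principle** `integral_norm_sq_weilMellin_mul_mono`
  (`σ ≤ Re ψ(1/4 + it/2)` pointwise implies the same for the weighted integrals);
* the Gram matrix `gramH a k l = ∫_{-a}^{a} (x/a)^{k+l} dx` and **Bessel's inequality**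
  `weilNorm2Sq_ge_bessel`: `2 Re Σ conj(u_k) M_k − Re Σ conj(u_k) u_l H_{kl} ≤ ‖g‖₂²` for every
  coefficient vector `u` (the `L²[-a,a]`-distance from `g` to a polynomial is non-negative).

Everything here is proved; there are no named facts.

## References

* H. Yoshida, *On Hermitian forms attached to zeta functions*, Adv. Stud. Pure Math. 21 (1992),
  281–325, §2 (2.1), §6.
* E. C. Titchmarsh, *Introduction to the Theory of Fourier Integrals*, Thm. 48 (Plancherel).
-/

noncomputable section

open Complex Filter Set MeasureTheory
open scoped Real Topology ComplexConjugate FourierTransform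



namespace Literature.NumberTheory.LFunctions

variable {g : ℝ → ℂ}

/-! ## Moments and norms of a test function supported in `[-a, a]` -/

/-- The scaled moments `M_k(g) = ∫ g(x) (x/a)^k dx` of a test function (the coordinates of the
finite-dimensional reduction). [folklore] -/
def weilMoment (a : ℝ) (g : ℝ → ℂ) (k : ℕ) : ℂ :=
  ∫ x : ℝ, g x * (((x / a) ^ k : ℝ) : ℂ)

/-- The plain `L¹` norm `∫ ‖g‖`. [folklore] -/
def weilNorm1 (g : ℝ → ℂ) : ℝ :=
  ∫ x : ℝ, ‖g x‖

/-- The squared `L²` norm `∫ ‖g‖²` (`= F(0)` for `F = g ⋆ g̃`, Yoshida §2). [folklore] -/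
def weilNorm2Sq (g : ℝ → ℂ) : ℝ :=
  ∫ x : ℝ, ‖g x‖ ^ 2

/-- `‖g‖₁ ≥ 0`. [folklore] -/
theorem weilNorm1_nonneg (g : ℝ → ℂ) : 0 ≤ weilNorm1 g :=
  integral_nonneg fun _ ↦ norm_nonneg _

/-- Bridge to the weighted norms of `WeilMellinInversion.lean`: `‖g‖₁ = weilL1W 0 g`
(the case `A = 0` of `∫ ‖g‖ e^{A|t|}`; compare `weilL1W_half`). [folklore] -/
theorem weilNorm1_eq_weilL1W_zero (g : ℝ → ℂ) : weilNorm1 g = weilL1W 0 g := by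
  unfold weilNorm1 weilL1W
  simp

/-- `‖g‖₂² ≥ 0`. [folklore] -/
theorem weilNorm2Sq_nonneg (g : ℝ → ℂ) : 0 ≤ weilNorm2Sq g :=
  integral_nonneg fun _ ↦ by positivity

/-- Off `[-a, a]` a function with `tsupport g ⊆ [-a, a]` vanishes. [folklore] -/
theorem eq_zero_of_tsupport_subset {a : ℝ} (hsupp : tsupport g ⊆ Icc (-a) a) {x : ℝ}
    (hx : x ∉ Icc (-a) a) : g x = 0 :=
  image_eq_zero_of_notMem_tsupport fun h ↦ hx (hsupp h)

/-- On `[-a, a]`, `|x/a| ≤ 1` (`a > 0`). [folklore] -/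
theorem abs_div_le_one_of_mem_Icc {a x : ℝ} (ha : 0 < a) (hx : x ∈ Icc (-a) a) :
    |x / a| ≤ 1 := by
  rw [abs_div, abs_of_pos ha, div_le_one ha]
  exact abs_le.2 ⟨hx.1, hx.2⟩

/-- Pointwise: `‖g(x) (x/a)^k‖ ≤ ‖g(x)‖` when `tsupport g ⊆ [-a, a]`. [folklore] -/
theorem norm_mul_pow_div_le {a : ℝ} (ha : 0 < a) (hsupp : tsupport g ⊆ Icc (-a) a) (k : ℕ)
    (x : ℝ) : ‖g x * (((x / a) ^ k : ℝ) : ℂ)‖ ≤ ‖g x‖ := by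
  by_cases hx : x ∈ Icc (-a) a
  · rw [norm_mul, Complex.norm_real, Real.norm_eq_abs, abs_pow]
    exact mul_le_of_le_one_right (norm_nonneg _) (pow_le_one₀ (abs_nonneg _)
      (abs_div_le_one_of_mem_Icc ha hx))
  · simp [eq_zero_of_tsupport_subset hsupp hx]

/-- Integrability of `g · h` for continuous `h` (test function `g`). [folklore] -/
theorem IsWeilTest.integrable_mul (hg : IsWeilTest g) {h : ℝ → ℂ} (hh : Continuous h) :
    Integrable fun x ↦ g x * h x :=
  (hg.1.continuous.mul hh).integrable_of_hasCompactSupport hg.2.mul_right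

/-- `‖M_k(g)‖ ≤ ‖g‖₁`. [folklore] -/
theorem norm_weilMoment_le (hg : IsWeilTest g) {a : ℝ} (ha : 0 < a)
    (hsupp : tsupport g ⊆ Icc (-a) a) (k : ℕ) : ‖weilMoment a g k‖ ≤ weilNorm1 g := by
  unfold weilMoment weilNorm1
  refine (norm_integral_le_integral_norm _).trans (integral_mono_of_nonneg
    (Eventually.of_forall fun _ ↦ norm_nonneg _) ?_
    (Eventually.of_forall fun x ↦ norm_mul_pow_div_le ha hsupp k x))
  exact (hg.1.continuous.norm).integrable_of_hasCompactSupport hg.2.norm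

/-- `‖g‖₁² ≤ 2a ‖g‖₂²` for `tsupport g ⊆ [-a, a]` (Cauchy–Schwarz, in the elementary form
`0 ≤ ∫_{[-a,a]} (‖g‖ - ‖g‖₁/2a)²`). [folklore] -/
theorem weilNorm1_sq_le (hg : IsWeilTest g) {a : ℝ} (ha : 0 < a)
    (hsupp : tsupport g ⊆ Icc (-a) a) : weilNorm1 g ^ 2 ≤ 2 * a * weilNorm2Sq g := by
  set L := weilNorm1 g with hL
  set μ : ℝ := L / (2 * a) with hμ
  have hgn : Continuous fun x ↦ ‖g x‖ := hg.1.continuous.norm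
  have hIcc : IsCompact (Icc (-a) a) := isCompact_Icc
  -- integrals over `[-a, a]`
  have i1 : ∫ x in Icc (-a) a, ‖g x‖ = L := by
    rw [hL, weilNorm1]
    exact setIntegral_eq_integral_of_forall_compl_eq_zero fun x hx ↦ by
      simp [eq_zero_of_tsupport_subset hsupp hx]
  have i2 : ∫ x in Icc (-a) a, ‖g x‖ ^ 2 = weilNorm2Sq g := by
    rw [weilNorm2Sq]
    exact setIntegral_eq_integral_of_forall_compl_eq_zero fun x hx ↦ by
      simp [eq_zero_of_tsupport_subset hsupp hx]
  have i3 : ∫ x in Icc (-a) a, (μ ^ 2 : ℝ) = 2 * a * μ ^ 2 := by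
    rw [setIntegral_const, smul_eq_mul, Real.volume_real_Icc_of_le (by linarith)]
    ring
  have hint1 : IntegrableOn (fun x ↦ ‖g x‖) (Icc (-a) a) :=
    hgn.continuousOn.integrableOn_compact hIcc
  have hint2 : IntegrableOn (fun x ↦ ‖g x‖ ^ 2) (Icc (-a) a) :=
    (hgn.pow 2).continuousOn.integrableOn_compact hIcc
  have hint3 : IntegrableOn (fun _ ↦ (μ ^ 2 : ℝ)) (Icc (-a) a) :=
    continuous_const.continuousOn.integrableOn_compact hIcc
  have key : 0 ≤ ∫ x in Icc (-a) a, (‖g x‖ - μ) ^ 2 :=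
    setIntegral_nonneg measurableSet_Icc fun x _ ↦ sq_nonneg _
  have expand : ∫ x in Icc (-a) a, (‖g x‖ - μ) ^ 2 =
      (∫ x in Icc (-a) a, ‖g x‖ ^ 2) - 2 * μ * (∫ x in Icc (-a) a, ‖g x‖) +
        ∫ x in Icc (-a) a, (μ ^ 2 : ℝ) := by
    have e : (fun x ↦ (‖g x‖ - μ) ^ 2) =
        fun x ↦ ‖g x‖ ^ 2 - 2 * μ * ‖g x‖ + μ ^ 2 := by
      funext x; ring
    have hA : Integrable (fun x ↦ ‖g x‖ ^ 2 - 2 * μ * ‖g x‖) (volume.restrict (Icc (-a) a)) :=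
      hint2.sub (hint1.const_mul _)
    rw [e, integral_add hA hint3, integral_sub hint2 (hint1.const_mul _), integral_const_mul]
  rw [expand, i1, i2, i3] at key
  -- key : 0 ≤ N2 - 2 μ L + 2 a μ², with 2 a μ = L
  have hμ' : 2 * a * μ = L := by
    rw [hμ]; field_simp
  have k1 : 2 * a * μ ^ 2 = μ * L := by rw [← hμ']; ring
  have k2 : L ^ 2 = 2 * a * (μ * L) := by rw [← hμ']; ring
  rw [k2]
  nlinarith

/-! ## The Taylor–moment lemma -/

/-- `ĝ(c + 1/2) = ∫ g(x) e^{cx} dx`. [folklore] -/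
theorem weilMellin_add_half (g : ℝ → ℂ) (c : ℂ) :
    weilMellin g (c + 1 / 2) = ∫ x : ℝ, g x * cexp (c * x) := by
  unfold weilMellin
  congr 1 with x
  congr 2
  ring

/-- The Taylor polynomial of the kernel against `g` is the moment sum:
`∫ g(x) Σ_{m ≤ N} (cx)^m/m! dx = Σ_{m ≤ N} (ca)^m/m! · M_m(g)`. [folklore] -/
theorem integral_mul_taylor_eq_sum_weilMoment (hg : IsWeilTest g) {a : ℝ} (ha : a ≠ 0) (c : ℂ)
    (N : ℕ) :
    ∫ x : ℝ, g x * ∑ m ∈ Finset.range (N + 1), (c * x) ^ m / m.factorial =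
      ∑ m ∈ Finset.range (N + 1), (c * a) ^ m / m.factorial * weilMoment a g m := by
  have e : ∀ x : ℝ, g x * ∑ m ∈ Finset.range (N + 1), (c * x) ^ m / m.factorial =
      ∑ m ∈ Finset.range (N + 1), (c * a) ^ m / m.factorial * (g x * (((x / a) ^ m : ℝ) : ℂ)) := by
    intro x
    rw [Finset.mul_sum]
    refine Finset.sum_congr rfl fun m _ ↦ ?_
    have ha' : (a : ℂ) ≠ 0 := Complex.ofReal_ne_zero.2 ha
    have : (c * x) ^ m = (c * a) ^ m * (((x / a) ^ m : ℝ) : ℂ) := by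
      push_cast
      rw [← mul_pow]
      congr 1
      field_simp
    rw [this]
    ring
  simp_rw [e]
  rw [integral_finsetSum _ fun m _ ↦ (hg.integrable_mul (by fun_prop)).const_mul _]
  refine Finset.sum_congr rfl fun m _ ↦ ?_
  rw [integral_const_mul]
  rfl

/-- **Taylor–moment lemma.** For a test function `g` with `tsupport g ⊆ [-a, a]` and
`‖c‖ a ≤ (N + 2)/2`:
`‖ĝ(c + 1/2) − Σ_{m ≤ N} (ca)^m/m! M_m(g)‖ ≤ 2 (‖c‖a)^{N+1}/(N+1)! · ‖g‖₁`
(Taylor expansion of `e^{cx}` on `[-a, a]`, `Complex.exp_bound'`). [folklore] -/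
theorem norm_weilMellin_sub_sum_weilMoment_le (hg : IsWeilTest g) {a : ℝ} (ha : 0 < a)
    (hsupp : tsupport g ⊆ Icc (-a) a) (c : ℂ) (N : ℕ)
    (hc : ‖c‖ * a / (N + 2) ≤ 1 / 2) :
    ‖weilMellin g (c + 1 / 2) -
        ∑ m ∈ Finset.range (N + 1), (c * a) ^ m / m.factorial * weilMoment a g m‖ ≤
      2 * (‖c‖ * a) ^ (N + 1) / (N + 1).factorial * weilNorm1 g := by
  rw [weilMellin_add_half, ← integral_mul_taylor_eq_sum_weilMoment hg ha.ne' c N,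
    ← integral_sub (hg.integrable_mul (by fun_prop)) (hg.integrable_mul (by fun_prop))]
  simp_rw [← mul_sub]
  set B : ℝ := 2 * (‖c‖ * a) ^ (N + 1) / (N + 1).factorial with hB
  have hB0 : 0 ≤ B := by positivity
  have hpt : ∀ x : ℝ, ‖g x * (cexp (c * x) - ∑ m ∈ Finset.range (N + 1), (c * x) ^ m / m.factorial)‖
      ≤ B * ‖g x‖ := by
    intro x
    by_cases hx : x ∈ Icc (-a) a
    · rw [norm_mul, mul_comm]
      refine mul_le_mul_of_nonneg_right ?_ (norm_nonneg _)
      have hcx : ‖c * x‖ ≤ ‖c‖ * a := by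
        rw [norm_mul, Complex.norm_real, Real.norm_eq_abs]
        exact mul_le_mul_of_nonneg_left (abs_le.2 ⟨hx.1, hx.2⟩) (norm_nonneg _)
      have hcx' : ‖c * (x : ℂ)‖ / (Nat.succ (N + 1) : ℕ) ≤ 1 / 2 := by
        refine le_trans ?_ hc
        rw [Nat.cast_succ]
        push_cast
        rw [show (N : ℝ) + 1 + 1 = N + 2 by ring]
        exact div_le_div_of_nonneg_right hcx (by positivity)
      have h := Complex.exp_bound' (x := c * x) (n := N + 1) hcx'
      calc ‖cexp (c * x) - ∑ m ∈ Finset.range (N + 1), (c * x) ^ m / m.factorial‖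
          ≤ ‖c * (x : ℂ)‖ ^ (N + 1) / (N + 1).factorial * 2 := h
        _ ≤ (‖c‖ * a) ^ (N + 1) / (N + 1).factorial * 2 := by
            gcongr
        _ = B := by rw [hB]; ring
    · rw [eq_zero_of_tsupport_subset hsupp hx]
      simp
  calc ‖∫ x : ℝ, g x * (cexp (c * x) - ∑ m ∈ Finset.range (N + 1), (c * x) ^ m / m.factorial)‖
      ≤ ∫ x : ℝ, B * ‖g x‖ := by
        refine (norm_integral_le_integral_norm _).trans (integral_mono_of_nonneg
          (Eventually.of_forall fun _ ↦ norm_nonneg _) ?_ (Eventually.of_forall hpt))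
        exact ((hg.1.continuous.norm).integrable_of_hasCompactSupport hg.2.norm).const_mul B
    _ = B * weilNorm1 g := by rw [integral_const_mul]; rfl

end Literature.NumberTheory.LFunctions

namespace Literature.NumberTheory.LFunctions

variable {g : ℝ → ℂ}

/-! ## Crude bounds for `ĝ` on horizontal translates -/

/-- `‖ĝ(c + 1/2)‖ ≤ e^{|Re c| a} ‖g‖₁` for `tsupport g ⊆ [-a, a]`. [folklore] -/
theorem norm_weilMellin_add_half_le (hg : IsWeilTest g) {a : ℝ}
    (hsupp : tsupport g ⊆ Icc (-a) a) (c : ℂ) :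
    ‖weilMellin g (c + 1 / 2)‖ ≤ Real.exp (|c.re| * a) * weilNorm1 g := by
  rw [weilMellin_add_half]
  have hpt : ∀ x : ℝ, ‖g x * cexp (c * x)‖ ≤ Real.exp (|c.re| * a) * ‖g x‖ := by
    intro x
    by_cases hx : x ∈ Icc (-a) a
    · rw [norm_mul, Complex.norm_exp, mul_comm]
      refine mul_le_mul_of_nonneg_right (Real.exp_le_exp.2 ?_) (norm_nonneg _)
      have hre : (c * (x : ℂ)).re = c.re * x := by simp [mul_re]
      rw [hre]
      calc c.re * x ≤ |c.re * x| := le_abs_self _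
        _ = |c.re| * |x| := abs_mul _ _
        _ ≤ |c.re| * a := mul_le_mul_of_nonneg_left (abs_le.2 ⟨hx.1, hx.2⟩) (abs_nonneg _)
    · rw [eq_zero_of_tsupport_subset hsupp hx]
      simp
  calc ‖∫ x : ℝ, g x * cexp (c * x)‖ ≤ ∫ x : ℝ, Real.exp (|c.re| * a) * ‖g x‖ := by
        refine (norm_integral_le_integral_norm _).trans (integral_mono_of_nonneg
          (Eventually.of_forall fun _ ↦ norm_nonneg _) ?_ (Eventually.of_forall hpt))
        exact ((hg.1.continuous.norm).integrable_of_hasCompactSupport hg.2.norm).const_mul _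
    _ = Real.exp (|c.re| * a) * weilNorm1 g := by rw [integral_const_mul]; rfl

/-- On the critical line: `‖ĝ(1/2 + it)‖ ≤ ‖g‖₁` for every test function (the case `A = 0` of
`norm_weilMellin_le_weilL1W`). [folklore] -/
theorem norm_weilMellin_half_line_le (hg : IsWeilTest g) (t : ℝ) :
    ‖weilMellin g (1 / 2 + t * I)‖ ≤ weilNorm1 g := by
  rw [weilNorm1_eq_weilL1W_zero]
  exact norm_weilMellin_le_weilL1W hg.1.continuous hg.2 (by simp)

/-- At `s = 1` and `s = 0`: `‖ĝ(±1/2 + 1/2)‖ ≤ 2 ‖g‖₁` when `a ≤ 1` (`e^{a/2} ≤ 1 + 2·(a/2) ≤ 2`). [folklore] -/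
theorem norm_weilMellin_pm_half_le (hg : IsWeilTest g) {a : ℝ} (ha : 0 < a) (ha1 : a ≤ 1)
    (hsupp : tsupport g ⊆ Icc (-a) a) {σ : ℝ} (hσ : |σ| = 1 / 2) :
    ‖weilMellin g (σ + 1 / 2)‖ ≤ 2 * weilNorm1 g := by
  have h := norm_weilMellin_add_half_le hg hsupp σ
  simp only [Complex.ofReal_re] at h
  rw [hσ] at h
  refine h.trans (mul_le_mul_of_nonneg_right ?_ (weilNorm1_nonneg g))
  have hb := Real.exp_bound' (x := 1 / 2 * a) (by positivity) (by linarith) (n := 1) one_pos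
  simp only [Finset.range_one, Finset.sum_singleton, pow_zero, Nat.factorial_zero, Nat.cast_one,
    div_one, pow_one, Nat.factorial_one] at hb
  norm_num at hb
  linarith

/-! ## Plancherel for `ĝ` on the critical line -/

/-- **Plancherel in the `weilMellin` normalisation**: `∫ ‖ĝ(1/2 + it)‖² dt = 2π ‖g‖₂²`
(`ĝ(1/2 + it) = ∫ g(x) e^{itx} dx` is the Fourier transform at `-t/2π`; Titchmarsh, *Fourier
Integrals*, Thm. 48, via `Literature.Analysis.FunctionSpaces.integral_norm_sq_fourierIntegral_eq`). [folklore] -/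
theorem integral_norm_sq_weilMellin_half_line (hg : IsWeilTest g) :
    ∫ t : ℝ, ‖weilMellin g (1 / 2 + t * I)‖ ^ 2 = 2 * π * weilNorm2Sq g := by
  have hgc : Continuous g := hg.1.continuous
  have hgi : Integrable g := hgc.integrable_of_hasCompactSupport hg.2
  have hg2 : MemLp g 2 := hgc.memLp_of_hasCompactSupport hg.2
  have hP := Literature.Analysis.FunctionSpaces.integral_norm_sq_fourierIntegral_eq hgi hg2
  -- `𝓕 g w = ĝ(1/2 - 2π i w)`
  have hF : ∀ w : ℝ, 𝓕 g w = weilMellin g (1 / 2 + ((-(2 * π * w) : ℝ) : ℂ) * I) := by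
    intro w
    have h := fourier_weilKernel g (1 / 2) w
    have e : (fun t : ℝ ↦ g t * cexp ((((1 / 2 : ℝ) : ℂ) - 1 / 2) * t)) = g := by
      funext t; push_cast; simp
    rw [e] at h
    rw [h]
    push_cast
    ring_nf
  set f : ℝ → ℝ := fun t ↦ ‖weilMellin g (1 / 2 + t * I)‖ ^ 2 with hf
  have hsub := Measure.integral_comp_mul_left f (-(2 * π))
  have e1 : (fun w : ℝ ↦ f (-(2 * π) * w)) = fun w ↦ ‖𝓕 g w‖ ^ 2 := by
    funext w
    rw [hF, hf]
    simp only
    congr 3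
    push_cast
    ring
  rw [e1, hP] at hsub
  have hpi : |(-(2 * π))⁻¹| = (2 * π)⁻¹ := by
    rw [inv_neg, abs_neg, abs_of_pos (by positivity)]
  rw [hpi, smul_eq_mul] at hsub
  -- hsub : N2 = (2π)⁻¹ * ∫ f
  have h2pi : (0 : ℝ) < 2 * π := by positivity
  unfold weilNorm2Sq
  rw [hsub, ← mul_assoc, mul_inv_cancel₀ h2pi.ne', one_mul]

/-! ## Integrability of `‖ĝ(1/2 + it)‖² F(t)` for weights of quadratic growth -/

/-- `t ↦ ‖ĝ(1/2 + it)‖²` is continuous. [folklore] -/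
theorem continuous_norm_sq_weilMellin_half_line (hg : IsWeilTest g) :
    Continuous fun t : ℝ ↦ ‖weilMellin g (1 / 2 + t * I)‖ ^ 2 :=
  (((continuous_weilMellin hg.1.continuous hg.2).comp
    (by fun_prop : Continuous fun t : ℝ ↦ (1 / 2 : ℂ) + t * I)).norm).pow 2

/-- Decay on the critical line: `‖ĝ(1/2 + it)‖² ≤ C² (1 + t²)⁻²`. [folklore] -/
theorem norm_sq_weilMellin_half_line_le (hg : IsWeilTest g) (t : ℝ) :
    ‖weilMellin g (1 / 2 + t * I)‖ ^ 2 ≤ weilDecayW 0 g ^ 2 * ((1 + t ^ 2)⁻¹) ^ 2 := by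
  have h := norm_weilMellin_vertical_le hg (1 / 2) t
  rw [show |(1 / 2 : ℝ) - 1 / 2| = 0 by norm_num] at h
  push_cast at h
  have h0 : 0 ≤ weilDecayW 0 g * (1 + t ^ 2)⁻¹ := by
    have := weilDecayW_nonneg 0 g; positivity
  calc ‖weilMellin g (1 / 2 + t * I)‖ ^ 2 ≤ (weilDecayW 0 g * (1 + t ^ 2)⁻¹) ^ 2 :=
        pow_le_pow_left₀ (norm_nonneg _) h 2
    _ = weilDecayW 0 g ^ 2 * ((1 + t ^ 2)⁻¹) ^ 2 := by ring

/-- **Integrability against weights of quadratic growth.** For a measurable weight with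
`|F(t)| ≤ A + B t²`, `t ↦ ‖ĝ(1/2 + it)‖² F(t)` is integrable (`‖ĝ(1/2+it)‖ = O((1+t²)⁻¹)`). [folklore] -/
theorem integrable_norm_sq_weilMellin_mul (hg : IsWeilTest g) {F : ℝ → ℝ} (hF : Measurable F)
    {A B : ℝ} (hA : 0 ≤ A) (hB : 0 ≤ B) (hFb : ∀ t, |F t| ≤ A + B * t ^ 2) :
    Integrable fun t : ℝ ↦ ‖weilMellin g (1 / 2 + t * I)‖ ^ 2 * F t := by
  set C := weilDecayW 0 g with hC
  refine Integrable.mono' (integrable_inv_one_add_sq.const_mul (C ^ 2 * (A + B)))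
    ((continuous_norm_sq_weilMellin_half_line hg).measurable.mul hF).aestronglyMeasurable
    (Eventually.of_forall fun t ↦ ?_)
  rw [Real.norm_eq_abs, abs_mul, abs_of_nonneg (by positivity : (0 : ℝ) ≤ _)]
  have h1 := norm_sq_weilMellin_half_line_le hg t
  have h2 := hFb t
  have hpos : 0 < 1 + t ^ 2 := by positivity
  have h3 : (A + B * t ^ 2) * (1 + t ^ 2)⁻¹ ≤ A + B := by
    rw [mul_inv_le_iff₀ hpos]
    nlinarith [sq_nonneg t]
  calc ‖weilMellin g (1 / 2 + t * I)‖ ^ 2 * |F t|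
      ≤ C ^ 2 * ((1 + t ^ 2)⁻¹) ^ 2 * (A + B * t ^ 2) :=
        mul_le_mul h1 h2 (abs_nonneg _) (by positivity)
    _ = C ^ 2 * ((A + B * t ^ 2) * (1 + t ^ 2)⁻¹) * (1 + t ^ 2)⁻¹ := by ring
    _ ≤ C ^ 2 * (A + B) * (1 + t ^ 2)⁻¹ := by
        refine mul_le_mul_of_nonneg_right (mul_le_mul_of_nonneg_left h3 (sq_nonneg _)) ?_
        positivity

/-- In particular `t ↦ ‖ĝ(1/2 + it)‖²` is integrable. [folklore] -/
theorem integrable_norm_sq_weilMellin_half_line (hg : IsWeilTest g) :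
    Integrable fun t : ℝ ↦ ‖weilMellin g (1 / 2 + t * I)‖ ^ 2 := by
  have h := integrable_norm_sq_weilMellin_mul hg measurable_const (A := 1) (B := 0) zero_le_one
    le_rfl (F := fun _ ↦ 1) (fun t ↦ by simp)
  simpa using h

/-- `t ↦ ‖ĝ(1/2 + it)‖² Re ψ(1/4 + it/2)` is integrable (the archimedean integral of Yoshida's
form (2.1) converges absolutely). [folklore] -/
theorem integrable_norm_sq_weilMellin_mul_reDigammaQuarter (hg : IsWeilTest g) :
    Integrable fun t : ℝ ↦ ‖weilMellin g (1 / 2 + t * I)‖ ^ 2 * Literature.Analysis.SpecialFunctions.reDigammaQuarter t :=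
  integrable_norm_sq_weilMellin_mul hg Literature.Analysis.SpecialFunctions.measurable_reDigammaQuarter (abs_nonneg _)
    (by norm_num) Literature.Analysis.SpecialFunctions.abs_reDigammaQuarter_le

/-- **The minorant principle.** If a measurable `σ` of quadratic growth satisfies
`σ(t) ≤ Re ψ(1/4 + it/2)` for all `t`, then
`∫ ‖ĝ(1/2+it)‖² σ(t) dt ≤ ∫ ‖ĝ(1/2+it)‖² Re ψ(1/4 + it/2) dt`. [folklore] -/
theorem integral_norm_sq_weilMellin_mul_mono (hg : IsWeilTest g) {σ : ℝ → ℝ} (hσ : Measurable σ)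
    {A B : ℝ} (hA : 0 ≤ A) (hB : 0 ≤ B) (hσb : ∀ t, |σ t| ≤ A + B * t ^ 2)
    (hle : ∀ t, σ t ≤ Literature.Analysis.SpecialFunctions.reDigammaQuarter t) :
    ∫ t : ℝ, ‖weilMellin g (1 / 2 + t * I)‖ ^ 2 * σ t ≤
      ∫ t : ℝ, ‖weilMellin g (1 / 2 + t * I)‖ ^ 2 * Literature.Analysis.SpecialFunctions.reDigammaQuarter t :=
  integral_mono (integrable_norm_sq_weilMellin_mul hg hσ hA hB hσb)
    (integrable_norm_sq_weilMellin_mul_reDigammaQuarter hg)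
    fun t ↦ mul_le_mul_of_nonneg_left (hle t) (sq_nonneg _)

end Literature.NumberTheory.LFunctions

namespace Literature.NumberTheory.LFunctions

variable {g : ℝ → ℂ}

/-! ## Gram matrix of the monomials and Bessel's inequality -/

/-- The Gram matrix of the monomials `(x/a)^k` on `[-a, a]`:
`H_{kl}(a) = ∫_{-a}^{a} (x/a)^{k+l} dx = a (1 + (-1)^{k+l})/(k + l + 1)`. [folklore] -/
def gramH (a : ℝ) (k l : ℕ) : ℝ :=
  a * (1 + (-1) ^ (k + l)) / (k + l + 1)

/-- `∫_{-a}^{a} (x/a)^q dx = a (1 + (-1)^q)/(q+1)` (`a ≠ 0`). [folklore] -/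
theorem integral_pow_div_eq {a : ℝ} (ha : a ≠ 0) (q : ℕ) :
    ∫ x in (-a)..a, (x / a) ^ q = a * (1 + (-1) ^ q) / (q + 1) := by
  have h := intervalIntegral.integral_comp_div (f := fun y : ℝ ↦ y ^ q) (a := -a) (b := a) ha
  rw [h, neg_div, div_self ha, integral_pow, smul_eq_mul, one_pow, pow_succ]
  ring

/-- `∫_{-a}^{a} (x/a)^k (x/a)^l dx = H_{kl}(a)`. [folklore] -/
theorem integral_pow_div_mul_pow_div {a : ℝ} (ha : a ≠ 0) (k l : ℕ) :
    ∫ x in (-a)..a, (x / a) ^ k * (x / a) ^ l = gramH a k l := by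
  simp_rw [← pow_add]
  rw [integral_pow_div_eq ha, gramH]
  push_cast
  ring

/-- For `tsupport g ⊆ [-a, a]`: whole-line integrals of `g · h` are interval integrals over
`[-a, a]`. [folklore] -/
theorem integral_eq_intervalIntegral_of_tsupport (hgc : Continuous g) {a : ℝ}
    (hsupp : tsupport g ⊆ Icc (-a) a) (h : ℝ → ℂ) :
    ∫ x : ℝ, g x * h x = ∫ x in (-a)..a, g x * h x := by
  symm
  apply intervalIntegral.integral_eq_integral_of_support_subset
  intro x hx
  have hgx : g x ≠ 0 := fun h0 ↦ hx (by simp [h0])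
  exact Ioo_subset_Ioc_self (support_subset_Ioo_of_tsupport_subset_Icc hgc hsupp hgx)

/-- `‖z - w‖² = ‖z‖² + ‖w‖² - 2 Re(z conj w)`. [folklore] -/
theorem norm_sub_sq_complex (z w : ℂ) :
    ‖z - w‖ ^ 2 = ‖z‖ ^ 2 + ‖w‖ ^ 2 - 2 * (z * conj w).re := by
  rw [Complex.sq_norm, Complex.sq_norm, Complex.sq_norm]
  exact Complex.normSq_sub z w

/-- **Bessel's inequality for the monomials** (the `L²[-a, a]`-distance from `g` to any polynomial
`Σ_{k<n} u_k (x/a)^k` is non-negative): for `tsupport g ⊆ [-a, a]`,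
`2 Re Σ_k conj(u_k) M_k(g) − Re Σ_{k,l} conj(u_k) u_l H_{kl}(a) ≤ ‖g‖₂²`. [folklore] -/
theorem weilNorm2Sq_ge_bessel (hg : IsWeilTest g) {a : ℝ} (ha : 0 < a)
    (hsupp : tsupport g ⊆ Icc (-a) a) (n : ℕ) (u : ℕ → ℂ) :
    2 * (∑ k ∈ Finset.range n, conj (u k) * weilMoment a g k).re -
        (∑ k ∈ Finset.range n, ∑ l ∈ Finset.range n,
          conj (u k) * u l * (gramH a k l : ℂ)).re ≤
      weilNorm2Sq g := by
  have hgc : Continuous g := hg.1.continuous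
  have hab : -a ≤ a := by linarith
  set mon : ℕ → ℝ → ℂ := fun k x ↦ (((x / a) ^ k : ℝ) : ℂ) with hmon
  have hmonc : ∀ k, Continuous (mon k) := fun k ↦ by rw [hmon]; fun_prop
  have hmonr : ∀ k x, conj (mon k x) = mon k x := fun k x ↦ by
    rw [hmon]; exact Complex.conj_ofReal _
  set Q : ℝ → ℂ := fun x ↦ ∑ k ∈ Finset.range n, u k * mon k x with hQ
  have hQc : Continuous Q := by
    rw [hQ]
    exact continuous_finsetSum _ fun k _ ↦ continuous_const.mul (hmonc k)
  have hQs : Continuous fun x ↦ conj (Q x) := Complex.continuous_conj.comp hQc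
  -- (1) `0 ≤ ∫_{-a}^{a} ‖g - Q‖²`
  have h0 : 0 ≤ ∫ x in (-a)..a, ‖g x - Q x‖ ^ 2 :=
    intervalIntegral.integral_nonneg hab fun x _ ↦ sq_nonneg _
  -- (2) expand the square
  have i1 : IntervalIntegrable (fun x ↦ ‖g x‖ ^ 2) volume (-a) a :=
    ((hgc.norm).pow 2).intervalIntegrable _ _
  have i2 : IntervalIntegrable (fun x ↦ ‖Q x‖ ^ 2) volume (-a) a :=
    ((hQc.norm).pow 2).intervalIntegrable _ _
  have iGQ : IntervalIntegrable (fun x ↦ g x * conj (Q x)) volume (-a) a :=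
    (hgc.mul hQs).intervalIntegrable _ _
  have iQQ : IntervalIntegrable (fun x ↦ conj (Q x) * Q x) volume (-a) a :=
    (hQs.mul hQc).intervalIntegrable _ _
  have i3 : IntervalIntegrable (fun x ↦ 2 * (g x * conj (Q x)).re) volume (-a) a :=
    (continuous_const.mul (Complex.continuous_re.comp (hgc.mul hQs))).intervalIntegrable _ _
  have hexp : ∫ x in (-a)..a, ‖g x - Q x‖ ^ 2 =
      (∫ x in (-a)..a, ‖g x‖ ^ 2) + (∫ x in (-a)..a, ‖Q x‖ ^ 2) -
        2 * ∫ x in (-a)..a, (g x * conj (Q x)).re := by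
    simp_rw [norm_sub_sq_complex]
    rw [intervalIntegral.integral_sub (i1.add i2) i3, intervalIntegral.integral_add i1 i2,
      intervalIntegral.integral_const_mul]
  -- (3) `∫_{-a}^{a} ‖g‖² = ‖g‖₂²`
  have hN : ∫ x in (-a)..a, ‖g x‖ ^ 2 = weilNorm2Sq g := by
    rw [weilNorm2Sq]
    apply intervalIntegral.integral_eq_integral_of_support_subset
    intro x hx
    have hgx : g x ≠ 0 := fun h0 ↦ hx (by simp [h0])
    exact Ioo_subset_Ioc_self (support_subset_Ioo_of_tsupport_subset_Icc hgc hsupp hgx)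
  -- `∫ Re = Re ∫` on `[-a, a]`
  have hre : ∀ {F : ℝ → ℂ}, IntervalIntegrable F volume (-a) a →
      ∫ x in (-a)..a, (F x).re = (∫ x in (-a)..a, F x).re := by
    intro F hF
    have := ContinuousLinearMap.intervalIntegral_comp_comm Complex.reCLM hF
    simpa only [Complex.reCLM_apply] using this
  -- (4) the cross term
  have hcross : ∫ x in (-a)..a, (g x * conj (Q x)).re =
      (∑ k ∈ Finset.range n, conj (u k) * weilMoment a g k).re := by
    have e1 : ∀ x, g x * conj (Q x) = ∑ k ∈ Finset.range n, conj (u k) * (g x * mon k x) := by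
      intro x
      rw [hQ]
      simp only [map_sum, map_mul, hmonr, Finset.mul_sum]
      refine Finset.sum_congr rfl fun k _ ↦ ?_
      ring
    rw [hre iGQ]
    congr 1
    simp_rw [e1]
    have iGm : ∀ k, IntervalIntegrable (fun x ↦ conj (u k) * (g x * mon k x)) volume (-a) a :=
      fun k ↦ (continuous_const.mul (hgc.mul (hmonc k))).intervalIntegrable _ _
    rw [intervalIntegral.integral_finsetSum fun k _ ↦ iGm k]
    refine Finset.sum_congr rfl fun k _ ↦ ?_
    rw [intervalIntegral.integral_const_mul, weilMoment,
      integral_eq_intervalIntegral_of_tsupport hgc hsupp]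
  -- (5) the polynomial term
  have hpoly : ∫ x in (-a)..a, ‖Q x‖ ^ 2 =
      (∑ k ∈ Finset.range n, ∑ l ∈ Finset.range n, conj (u k) * u l * (gramH a k l : ℂ)).re := by
    have e1 : ∀ x, (‖Q x‖ ^ 2 : ℝ) = (conj (Q x) * Q x).re := by
      intro x
      rw [Complex.sq_norm, ← Complex.normSq_eq_conj_mul_self]
      simp
    have e2 : ∀ x, conj (Q x) * Q x =
        ∑ k ∈ Finset.range n, ∑ l ∈ Finset.range n, conj (u k) * u l * (mon k x * mon l x) := by
      intro x
      rw [hQ]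
      simp only [map_sum, map_mul, hmonr]
      rw [Finset.sum_mul_sum]
      refine Finset.sum_congr rfl fun k _ ↦ Finset.sum_congr rfl fun l _ ↦ ?_
      ring
    have hmm : ∀ k l, ∫ x in (-a)..a, mon k x * mon l x = (gramH a k l : ℂ) := by
      intro k l
      rw [hmon]
      simp only
      simp_rw [← Complex.ofReal_mul]
      rw [intervalIntegral.integral_ofReal, integral_pow_div_mul_pow_div ha.ne']
    simp_rw [e1]
    rw [hre iQQ]
    congr 1
    simp_rw [e2]
    have iKL : ∀ k l, IntervalIntegrable (fun x ↦ conj (u k) * u l * (mon k x * mon l x))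
        volume (-a) a :=
      fun k l ↦ (continuous_const.mul ((hmonc k).mul (hmonc l))).intervalIntegrable _ _
    have iK : ∀ k, IntervalIntegrable
        (fun x ↦ ∑ l ∈ Finset.range n, conj (u k) * u l * (mon k x * mon l x)) volume (-a) a :=
      fun k ↦ (continuous_finsetSum _ fun l _ ↦
        continuous_const.mul ((hmonc k).mul (hmonc l))).intervalIntegrable _ _
    rw [intervalIntegral.integral_finsetSum fun k _ ↦ iK k]
    refine Finset.sum_congr rfl fun k _ ↦ ?_
    rw [intervalIntegral.integral_finsetSum fun l _ ↦ iKL k l]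
    refine Finset.sum_congr rfl fun l _ ↦ ?_
    rw [intervalIntegral.integral_const_mul, hmm]
  rw [hexp, hN, hcross, hpoly] at h0
  linarith

end Literature.NumberTheory.LFunctions
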